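import Summits.QuantumFields.YangMills.Theorems.ColdStartUniversalityLatticeLangevinWilsonDirichletScaleSmallScales
import Summits.QuantumFields.YangMills.Theorems.ColdStartUniversalityLatticeLangevinWilsonDirichletScaleComparison
import Summits.QuantumFields.YangMills.Theorems.ColdStartUniversalityLatticeLangevinRidgeSmoothing
import HarnessLib

/-!
# Route `ColdStartUniversality` (fixed-cut-off `L²(μ_{β'})` package): APPROXIMATION IN ENERGY of a continuous observable by
# `C³` cylinder functions, part 1 — `L²` tools and the `β' = 0` energy bound (towards «generator-form Poincaré ⇒ `L²` decay»
# without smoothing hypothesis)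

Helper file (seat `ym-line-csu-p1`, g18; `--supports stmt-QuantumFields-27363`), PART 1 of the approximation-in-energy step (main
result in the sequel `…WilsonEnergyApproximation`).  For the SU(2) SZZ dynamics at `(L, β')`, `μ = μ_{β'}`,
`Q_h(w) = ∫ w² dμ − ∫ w κ_h w dμ = h 𝓔_h(w)`:

* `sq_integral_add_le` (the `L²` triangle inequality in `(1+t, 1+t⁻¹)` form), `variance_le_sq_integral`, `dirichletScale_sub_comm`
  (the form is even), `sq_integral_sub_transition_le` (`‖G − κ_sG‖²_{L²(μ)} ≤ Q_s(G) = s 𝓔_s(G)`);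
* ★ `exists_energy_bound_beta_zero` — if `𝓔_h(G) ≤ E` for all `h > 0` at coupling `β'`, then for any realising kernel family `κ⁰`
  of the `β' = 0` dynamics the energies `𝓔⁰_h(G)` are bounded (`exists_dirichletScale_le_mul_beta_zero` for `h ≤ 1`, monotonicity
  beyond) and `𝓔⁰_h(G − κ⁰_sG) ≤ 2ε` at small scales (`dirichletScale_sub_transition_le` at the supremum).

THEOREMS ONLY, no definition, no sorry.  HONEST FRAMING: RECORD-rung R3 plumbing at FIXED cut-off; nothing K-uniform is proved;
no crux, rung or summit statement is proved; the Yang–Mills mass gap is NOT proved.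
-/

set_option autoImplicit false

noncomputable section

namespace Summit.QuantumFields.YangMills.Theorems.ColdStartUniversality

open MeasureTheory ProbabilityTheory Filter Set Topology
open scoped BigOperators NNReal ENNReal
open Literature.Probability.Process Literature.MathematicalPhysics.QuantumFieldTheory
open Literature.MathematicalPhysics.QuantumLattice (fundamentalRep fundamentalLatticeRep continuous_fundamentalRep)

variable {L : ℕ} [NeZero L]

/-! ## §1. Small `L²` tools -/

/-- **`L²` triangle inequality, `(1+t, 1+t⁻¹)` form**: `∫ (a+b)² dν ≤ (1+t) ∫ a² dν + (1+t⁻¹) ∫ b² dν` for continuous `a, b` on the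
compact configuration space and a finite measure `ν` (`2ab ≤ t a² + t⁻¹ b²` pointwise). [folklore] -/
theorem sq_integral_add_le {ν : Measure (GaugeConfig 3 L (Matrix.specialUnitaryGroup (Fin 2) ℂ))} [IsFiniteMeasure ν]
    {a b : GaugeConfig 3 L (Matrix.specialUnitaryGroup (Fin 2) ℂ) → ℝ} (ha : Continuous a) (hb : Continuous b)
    {t : ℝ} (ht : 0 < t) :
    ∫ x, (a x + b x) ^ 2 ∂ν ≤ (1 + t) * ∫ x, (a x) ^ 2 ∂ν + (1 + t⁻¹) * ∫ x, (b x) ^ 2 ∂ν := by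
  haveI := secondCountableTopology_su2
  haveI := borelSpace_config L
  have ia : Integrable (fun x => (a x) ^ 2) ν := integrable_of_continuous_of_compactSpace (ha.pow 2) ν
  have ib : Integrable (fun x => (b x) ^ 2) ν := integrable_of_continuous_of_compactSpace (hb.pow 2) ν
  rw [← integral_const_mul, ← integral_const_mul, ← integral_add (ia.const_mul _) (ib.const_mul _)]
  refine integral_mono (integrable_of_continuous_of_compactSpace ((ha.add hb).pow 2) ν)
    ((ia.const_mul _).add (ib.const_mul _)) fun x => ?_
  dsimp only
  have h : 0 ≤ t⁻¹ * (t * a x - b x) ^ 2 := mul_nonneg (inv_nonneg.2 ht.le) (sq_nonneg _)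
  have e : (1 + t) * a x ^ 2 + (1 + t⁻¹) * b x ^ 2 - (a x + b x) ^ 2 = t⁻¹ * (t * a x - b x) ^ 2 := by
    field_simp; ring
  linarith [h, e]

/-- **Variance ≤ second moment**: `∫ (w − μw)² dμ_{β'} ≤ ∫ w² dμ_{β'}` for continuous `w`. [folklore] -/
theorem variance_le_sq_integral (β' : ℝ) {w : GaugeConfig 3 L (Matrix.specialUnitaryGroup (Fin 2) ℂ) → ℝ} (hw : Continuous w) :
    ∫ x, (w x - ∫ z, w z ∂(wilsonMeasure (d := 3) (L := L) (fundamentalRep (Fin 2)) β')) ^ 2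
        ∂(wilsonMeasure (d := 3) (L := L) (fundamentalRep (Fin 2)) β') ≤
      ∫ x, (w x) ^ 2 ∂(wilsonMeasure (d := 3) (L := L) (fundamentalRep (Fin 2)) β') := by
  classical
  haveI := secondCountableTopology_su2
  haveI := borelSpace_config L
  set μ : Measure (GaugeConfig 3 L (Matrix.specialUnitaryGroup (Fin 2) ℂ)) :=
    wilsonMeasure (d := 3) (L := L) (fundamentalRep (Fin 2)) β' with hμ
  haveI : IsProbabilityMeasure μ :=
    isProbabilityMeasure_wilsonMeasure (d := 3) (L := L) (fundamentalRep (Fin 2)) (continuous_fundamentalRep (Fin 2)) β'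
  set m : ℝ := ∫ z, w z ∂μ with hm
  have iw : Integrable w μ := integrable_of_continuous_of_compactSpace hw μ
  have iw2 : Integrable (fun x => (w x) ^ 2) μ := integrable_of_continuous_of_compactSpace (hw.pow 2) μ
  have e : ∀ x, (w x - m) ^ 2 = ((w x) ^ 2 - 2 * m * w x) + m ^ 2 := by intro x; ring
  simp_rw [e]
  have i1 : Integrable (fun x => 2 * m * w x) μ := iw.const_mul _
  have i12 : Integrable (fun x => (w x) ^ 2 - 2 * m * w x) μ := iw2.sub i1
  rw [integral_add i12 (integrable_const _), integral_sub iw2 i1, integral_const_mul, integral_const, probReal_univ, one_smul,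
    ← hm]
  nlinarith [sq_nonneg m]

/-- `Q_h(u − v) = Q_h(v − u)` (the form is even). [folklore] -/
theorem dirichletScale_sub_comm {κh : Kernel (GaugeConfig 3 L (Matrix.specialUnitaryGroup (Fin 2) ℂ))
      (GaugeConfig 3 L (Matrix.specialUnitaryGroup (Fin 2) ℂ))} [IsMarkovKernel κh]
    {ν : Measure (GaugeConfig 3 L (Matrix.specialUnitaryGroup (Fin 2) ℂ))}
    {u v : GaugeConfig 3 L (Matrix.specialUnitaryGroup (Fin 2) ℂ) → ℝ} (hu : Continuous u) (hv : Continuous v) :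
    (∫ x, (u x - v x) * (u x - v x) ∂ν) - ∫ x, (u x - v x) * (∫ y, (u y - v y) ∂(κh x)) ∂ν =
      (∫ x, (v x - u x) * (v x - u x) ∂ν) - ∫ x, (v x - u x) * (∫ y, (v y - u y) ∂(κh x)) ∂ν := by
  have hint : ∀ x, Integrable (fun y => u y - v y) (κh x) := fun x => by
    obtain ⟨M, -, hM⟩ := exists_abs_le_of_continuous (hu.sub hv)
    exact Integrable.of_bound (hu.sub hv).aestronglyMeasurable M
      (Eventually.of_forall fun z => by rw [Real.norm_eq_abs]; exact hM z)
  have e1 : ∀ x, ∫ y, (v y - u y) ∂(κh x) = -∫ y, (u y - v y) ∂(κh x) := by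
    intro x; rw [← integral_neg]; exact integral_congr_ae (Eventually.of_forall fun y => by simp)
  congr 1
  · exact integral_congr_ae (Eventually.of_forall fun x => by ring)
  · simp_rw [e1]; exact integral_congr_ae (Eventually.of_forall fun x => by ring)

/-- **`‖G − κ_sG‖²_{L²(μ)} ≤ Q_s(G) = s 𝓔_s(G)`** for continuous `G`: `‖G − κ_sG‖² = Q_s(G) − (∫ Gκ_sG − ∫ Gκ_{2s}G)` and the
autocorrelation function is non-increasing (`integral_mul_transition_self_antitone`). [folklore] -/
theorem sq_integral_sub_transition_le (L : ℕ) [NeZero L] (β' : ℝ)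
    (κ : ℝ≥0 → Kernel (GaugeConfig 3 L (Matrix.specialUnitaryGroup (Fin 2) ℂ))
      (GaugeConfig 3 L (Matrix.specialUnitaryGroup (Fin 2) ℂ))) [∀ t, IsMarkovKernel (κ t)]
    (hreal : ∀ (t : ℝ≥0) (x : GaugeConfig 3 L (Matrix.specialUnitaryGroup (Fin 2) ℂ))
        (Ω : Type) [MeasurableSpace Ω] (P : Measure Ω) [IsProbabilityMeasure P]
        (W : ℝ≥0 → Ω → (Edge 3 L × NoiseIdx 2 → ℝ)) (hW : IsFlatBrownian W P)
        (U : ℝ≥0 → Ω → GaugeConfig 3 L (Matrix.specialUnitaryGroup (Fin 2) ℂ)),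
        (∀ ω, U 0 ω = x) →
        (latticeLangevinDynamics (fundamentalLatticeRep 2) β').IsSolution (fundamentalRep (Fin 2))
          hW.natFiltration P W U →
        κ t x = P.map (U t))
    (s : ℝ≥0) {G : GaugeConfig 3 L (Matrix.specialUnitaryGroup (Fin 2) ℂ) → ℝ} (hG : Continuous G) :
    ∫ x, (G x - ∫ y, G y ∂(κ s x)) ^ 2 ∂(wilsonMeasure (d := 3) (L := L) (fundamentalRep (Fin 2)) β') ≤
      (∫ x, G x * G x ∂(wilsonMeasure (d := 3) (L := L) (fundamentalRep (Fin 2)) β')) -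
        ∫ x, G x * (∫ y, G y ∂(κ s x)) ∂(wilsonMeasure (d := 3) (L := L) (fundamentalRep (Fin 2)) β') := by
  classical
  haveI := secondCountableTopology_su2
  haveI := borelSpace_config L
  set μ : Measure (GaugeConfig 3 L (Matrix.specialUnitaryGroup (Fin 2) ℂ)) :=
    wilsonMeasure (d := 3) (L := L) (fundamentalRep (Fin 2)) β' with hμ
  haveI : IsProbabilityMeasure μ :=
    isProbabilityMeasure_wilsonMeasure (d := 3) (L := L) (fundamentalRep (Fin 2)) (continuous_fundamentalRep (Fin 2)) β'
  have hKc : Continuous fun x => ∫ y, G y ∂(κ s x) := continuous_integral_transitionKernel L β' κ hreal s hG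
  have e1 : ∀ x, (G x - ∫ y, G y ∂(κ s x)) ^ 2 =
      (G x * G x - 2 * (G x * ∫ y, G y ∂(κ s x))) + (∫ y, G y ∂(κ s x)) ^ 2 := by intro x; ring
  simp_rw [e1]
  have i1 : Integrable (fun x => G x * G x) μ := integrable_of_continuous_of_compactSpace (hG.mul hG) μ
  have i2 : Integrable (fun x => 2 * (G x * ∫ y, G y ∂(κ s x))) μ :=
    (integrable_of_continuous_of_compactSpace (hG.mul hKc) μ).const_mul _
  have i3 : Integrable (fun x => (∫ y, G y ∂(κ s x)) ^ 2) μ := integrable_of_continuous_of_compactSpace (hKc.pow 2) μ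
  have i12 : Integrable (fun x => G x * G x - 2 * (G x * ∫ y, G y ∂(κ s x))) μ := i1.sub i2
  rw [integral_add i12 i3, integral_sub i1 i2, integral_const_mul, ← integral_mul_transition_self_eq_sq L β' κ hreal s hG]
  have hanti := integral_mul_transition_self_antitone L β' κ hreal s s hG
  linarith

/-! ## §2. Finite energy at `β'` ⇒ finite energy at `0` and smallness at small scales -/

/-- **From finite `β'`-energy to the `β' = 0` dynamics**: if `𝓔_h(G) ≤ E` for all `h > 0`, then for any realising kernel family
`κ⁰` of the `β' = 0` dynamics there is `E₀ ≥ 0` with `𝓔⁰_h(G) ≤ E₀` for all `h > 0` (comparison for `h ≤ 1`, monotonicity in `h`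
beyond), and for every `ε > 0` there are `s₀, h₀ > 0` with `𝓔⁰_h(G − κ⁰_sG) ≤ 2ε` for `0 < s ≤ s₀`, `0 < h ≤ h₀`
(`dirichletScale_sub_transition_le` at the supremum `E₀`). [folklore] -/
theorem exists_energy_bound_beta_zero (L : ℕ) [NeZero L] (β' : ℝ)
    (κ : ℝ≥0 → Kernel (GaugeConfig 3 L (Matrix.specialUnitaryGroup (Fin 2) ℂ))
      (GaugeConfig 3 L (Matrix.specialUnitaryGroup (Fin 2) ℂ))) [∀ t, IsMarkovKernel (κ t)]
    (hreal : ∀ (t : ℝ≥0) (x : GaugeConfig 3 L (Matrix.specialUnitaryGroup (Fin 2) ℂ))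
        (Ω : Type) [MeasurableSpace Ω] (P : Measure Ω) [IsProbabilityMeasure P]
        (W : ℝ≥0 → Ω → (Edge 3 L × NoiseIdx 2 → ℝ)) (hW : IsFlatBrownian W P)
        (U : ℝ≥0 → Ω → GaugeConfig 3 L (Matrix.specialUnitaryGroup (Fin 2) ℂ)),
        (∀ ω, U 0 ω = x) →
        (latticeLangevinDynamics (fundamentalLatticeRep 2) β').IsSolution (fundamentalRep (Fin 2))
          hW.natFiltration P W U →
        κ t x = P.map (U t))
    (κ₀ : ℝ≥0 → Kernel (GaugeConfig 3 L (Matrix.specialUnitaryGroup (Fin 2) ℂ))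
      (GaugeConfig 3 L (Matrix.specialUnitaryGroup (Fin 2) ℂ))) [∀ t, IsMarkovKernel (κ₀ t)]
    (hreal₀ : ∀ (t : ℝ≥0) (x : GaugeConfig 3 L (Matrix.specialUnitaryGroup (Fin 2) ℂ))
        (Ω : Type) [MeasurableSpace Ω] (P : Measure Ω) [IsProbabilityMeasure P]
        (W : ℝ≥0 → Ω → (Edge 3 L × NoiseIdx 2 → ℝ)) (hW : IsFlatBrownian W P)
        (U : ℝ≥0 → Ω → GaugeConfig 3 L (Matrix.specialUnitaryGroup (Fin 2) ℂ)),
        (∀ ω, U 0 ω = x) →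
        (latticeLangevinDynamics (fundamentalLatticeRep 2) 0).IsSolution (fundamentalRep (Fin 2))
          hW.natFiltration P W U →
        κ₀ t x = P.map (U t))
    {G : GaugeConfig 3 L (Matrix.specialUnitaryGroup (Fin 2) ℂ) → ℝ} (hG : Continuous G) {E : ℝ}
    (hE : ∀ h : ℝ≥0, 0 < h →
      (h : ℝ)⁻¹ * ((∫ x, G x * G x ∂(wilsonMeasure (d := 3) (L := L) (fundamentalRep (Fin 2)) β')) -
        ∫ x, G x * (∫ y, G y ∂(κ h x)) ∂(wilsonMeasure (d := 3) (L := L) (fundamentalRep (Fin 2)) β')) ≤ E) :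
    ∃ E₀ : ℝ, 0 ≤ E₀ ∧
      (∀ h : ℝ≥0, 0 < h →
        (h : ℝ)⁻¹ * ((∫ x, G x * G x ∂(wilsonMeasure (d := 3) (L := L) (fundamentalRep (Fin 2)) 0)) -
          ∫ x, G x * (∫ y, G y ∂(κ₀ h x)) ∂(wilsonMeasure (d := 3) (L := L) (fundamentalRep (Fin 2)) 0)) ≤ E₀) ∧
      ∀ ε : ℝ, 0 < ε → ∃ s₀ : ℝ≥0, 0 < s₀ ∧ ∃ h₀ : ℝ≥0, 0 < h₀ ∧ ∀ s : ℝ≥0, 0 < s → s ≤ s₀ → ∀ h : ℝ≥0, 0 < h → h ≤ h₀ →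
        (h : ℝ)⁻¹ * ((∫ x, (G x - ∫ y, G y ∂(κ₀ s x)) * (G x - ∫ y, G y ∂(κ₀ s x))
            ∂(wilsonMeasure (d := 3) (L := L) (fundamentalRep (Fin 2)) 0)) -
          ∫ x, (G x - ∫ y, G y ∂(κ₀ s x)) * (∫ y, (G y - ∫ z, G z ∂(κ₀ s y)) ∂(κ₀ h x))
            ∂(wilsonMeasure (d := 3) (L := L) (fundamentalRep (Fin 2)) 0)) ≤ 2 * ε := by
  classical
  set μ : Measure (GaugeConfig 3 L (Matrix.specialUnitaryGroup (Fin 2) ℂ)) :=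
    wilsonMeasure (d := 3) (L := L) (fundamentalRep (Fin 2)) β' with hμ
  set μ₀ : Measure (GaugeConfig 3 L (Matrix.specialUnitaryGroup (Fin 2) ℂ)) :=
    wilsonMeasure (d := 3) (L := L) (fundamentalRep (Fin 2)) 0 with hμ₀
  obtain ⟨K, C, hC, hcmp⟩ := exists_dirichletScale_le_mul_beta_zero L β'
  -- the `β' = 0` energies of `G`
  set D₀ : ℝ≥0 → ℝ := fun h => (h : ℝ)⁻¹ * ((∫ x, G x * G x ∂μ₀) - ∫ x, G x * (∫ y, G y ∂(κ₀ h x)) ∂μ₀) with hD₀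
  have hE0 : 0 ≤ E := (dirichletScale_nonneg L β' κ hreal 1 hG).trans (hE 1 one_pos)
  set E₀' : ℝ := C * Real.exp |K| * E with hE₀'
  have hE₀'0 : 0 ≤ E₀' := by positivity
  -- bound for `h ≤ 1` by comparison, beyond by monotonicity
  have hb1 : ∀ h : ℝ≥0, 0 < h → h ≤ 1 → D₀ h ≤ E₀' := by
    intro h hh hh1
    have hcmp2 := (hcmp κ hreal κ₀ hreal₀ G hG h).2
    have hhR : (0 : ℝ) < h := by exact_mod_cast hh
    have hexp : Real.exp (K * h) ≤ Real.exp |K| := by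
      refine Real.exp_le_exp.2 ?_
      have h1 : (h : ℝ) ≤ 1 := by exact_mod_cast hh1
      calc K * h ≤ |K| * h := mul_le_mul_of_nonneg_right (le_abs_self K) hhR.le
        _ ≤ |K| * 1 := mul_le_mul_of_nonneg_left h1 (abs_nonneg K)
        _ = |K| := mul_one _
    have hQ : 0 ≤ (∫ x, G x * G x ∂μ) - ∫ x, G x * (∫ y, G y ∂(κ h x)) ∂μ := by
      have := dirichletScale_nonneg L β' κ hreal h hG
      rwa [mul_nonneg_iff_of_pos_left (inv_pos.2 hhR)] at this
    calc D₀ h ≤ (h : ℝ)⁻¹ * (C * Real.exp (K * h) * ((∫ x, G x * G x ∂μ) - ∫ x, G x * (∫ y, G y ∂(κ h x)) ∂μ)) :=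
          mul_le_mul_of_nonneg_left hcmp2 (inv_nonneg.2 hhR.le)
      _ = C * Real.exp (K * h) * ((h : ℝ)⁻¹ * ((∫ x, G x * G x ∂μ) - ∫ x, G x * (∫ y, G y ∂(κ h x)) ∂μ)) := by ring
      _ ≤ C * Real.exp |K| * E := by
          refine mul_le_mul (mul_le_mul_of_nonneg_left hexp hC.le) (hE h hh) ?_ (by positivity)
          exact mul_nonneg (inv_nonneg.2 hhR.le) hQ
  have hball : ∀ h : ℝ≥0, 0 < h → D₀ h ≤ E₀' := by
    intro h hh
    by_cases hh1 : h ≤ 1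
    · exact hb1 h hh hh1
    · have hanti := dirichletScale_antitone L 0 κ₀ hreal₀ (h := 1) (h' := h) one_pos (le_of_not_ge hh1) hG
      exact hanti.trans (hb1 1 one_pos le_rfl)
  -- the supremum of the `β' = 0` energies
  set S₀ : Set ℝ := D₀ '' Ioi (0 : ℝ≥0) with hS₀
  have hne : S₀.Nonempty := ⟨D₀ 1, 1, mem_Ioi.2 one_pos, rfl⟩
  have hbdd : BddAbove S₀ := ⟨E₀', by rintro _ ⟨h, hh, rfl⟩; exact hball h hh⟩
  set E₀ : ℝ := sSup S₀ with hE₀def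
  have hle : ∀ h : ℝ≥0, 0 < h → D₀ h ≤ E₀ := fun h hh => le_csSup hbdd ⟨h, mem_Ioi.2 hh, rfl⟩
  have hE₀0 : 0 ≤ E₀ := (dirichletScale_nonneg L 0 κ₀ hreal₀ 1 hG).trans (hle 1 one_pos)
  refine ⟨E₀, hE₀0, hle, fun ε hε => ?_⟩
  obtain ⟨_, ⟨h₁, hh₁, rfl⟩, hlt⟩ := exists_lt_of_lt_csSup hne (show E₀ - ε < sSup S₀ by linarith)
  exact dirichletScale_sub_transition_le L 0 κ₀ hreal₀ hG hle hε (mem_Ioi.1 hh₁) hlt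

end Summit.QuantumFields.YangMills.Theorems.ColdStartUniversality

end
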